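import Mathlib
import Summits.QuantumFields.YangMills.Theorems.BalabanUVNodesN15VectorCarrier
import Summits.QuantumFields.YangMills.Theorems.BalabanUVNodesN15MatrixSpecies
import HarnessLib

/-!
# Route «BalabanUVNodes» (cluster K4 «SpineRates»), Track-A DAG node N15 = spine estimate NE2, BACKGROUND LAYER — FIRST MISSING
# ESTIMATE, part 18: THE COVARIANT-DERIVATIVE SPECIES — the print's `D^η_U λ(b) = η⁻¹(R(U_b)λ(b₊) − λ(b₋))`, `R(U_b) = exp(iη ad_{A(b)})` ((3.50);
# `U_b = e^{iηA(b)}`, `A = (1∕iη) log U` the BACKGROUND's field, p. 399):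
# `D^η_U = M_R ∘ ∇_η + M_{η⁻¹(R − 1)}` with the TRANSPORT COEFFICIENT `R = exp(η ad_A)` (letters from 13a: `K = e·η₀`, `K′ = e·r`) INSIDE the derivative;
# products of matrix coefficients (row letters multiply), and the first term `i[A′(b), (D^η_U λ)(b)]` of (3.52) sandwiched WITH the transport

Cell `pub-ymgap`, seat `pub-ymgap-dag-n15-b` (generation g3; FIRST-MISSING-ESTIMATE, HUMAN RULING D-0062; chair R424 venue; ROSTER-D0062
l.26).  `bears_on: R4∕N15`.  Filed `--supports stmt-QuantumFields-19351`.  Removes the located caveat of parts 14∕17 (*«`U ≡ 1` lattice derivatives in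
the model; the print's `D^η_U` carries parallel transports — their coefficient is 13b's transporter species, composable by the same Leibniz rule, not
spelled out»*): here it is spelled out.
v1.0.1 (generation g4, 2026-08-26): DOCSTRING ONLY — header line above now reads `R(U_b) = exp(iη ad_{A(b)})` with the BACKGROUND's
`A = (1∕iη) log U` (p. 399; in (3.50) the primed `A′(b)` is the orientation-adjusted PERTURBATION field of `U′ = e^{iηA}`, p. 400, and
`R(U_b)` the background transport), prime dropped per referee READ-326 (A4 note); every declaration byte-identical to v1.0 (p437613).

WHY.  [Balaban1985BackgroundPropagators] (3.50) p. 400 (verbatim, first-hand; cross-read in 12c): the covariant Laplacian is built from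
*«η^{−2}(2dλ(x) − Σ_{b∈st(x)} exp(iη ad_{A′(b)}) R(U_b)λ(b₊))»*, i.e. the covariant derivative along a bond reads `λ` at the far end THROUGH the
transport `R = exp(η ad_{A(b)})`: `D^η λ(x) = η⁻¹(R(x)λ(s x) − λ(x)) = R(x)·(∇_η λ)(x) + η⁻¹(R(x) − 1)·λ(x)`.  So `D^η = M_R ∘ ∇_η + M_{Phi1-type}` with
TWO matrix coefficients, and the first term of (3.52), `M_{ad A} ∘ D^η = M_{(ad A)·R} ∘ ∇_η + M_{(ad A)·η⁻¹(R − 1)}`, is again «first-order matrix term +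
zeroth-order matrix term» — part 14's two sandwiches apply, with coefficients that are PRODUCTS.  The letters of products follow from the factors' (row
sums multiply; fits and bond differences by Leibniz), and the transport's own letters are 13a's Duhamel–Lipschitz (`‖e^{ηZ₁} − e^{ηZ₂}‖ ≤ e·η‖Z₁ − Z₂‖`:
Lipschitz constant `e·η₀`, itself small) and `‖e^{ηZ} − 1‖ ≤ e·r·η`.  THE PRINT USED (SHAPES only): (3.35) p. 396, (3.42) p. 397, (3.50)–(3.52) p. 400.
Nothing of [B9] asserted.

CONTENTS (all [folklore]; 13a∕13b∕14 BY NAME).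
* §1 THE TRANSPORT SPECIES on a complete real normed algebra: `Phi0 η Z = exp(ηZ)` (`Phi0 0 Z = 1`), `Phi0_lipschitz` (`K = e·η₀`), `Phi0_consistency`
  (`K′ = e·r`), `fit_Phi0_ad` (the print's `R(U_b) = exp(η ad_{A(b)})`: fit `≤ 2(eη₀)·o + 2(e·2r)·η`); `norm_mul_sub_mul_le_of` (Leibniz for fits of PRODUCTS:
  `‖a′b′ − ab‖ ≤ ‖a′‖‖b′ − b‖ + ‖a′ − a‖‖b‖`).
* §2 PRODUCTS OF MATRIX COEFFICIENTS on the product carrier: `mmulOp_comp_mmulOp` (`M_C ∘ M_R = M_{CR}`), `row_abs_sum_mul_le` (rows `≤ αβ`),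
  `rowFit_mul_le` (fit rows `≤ α′·o_R + o_C·β`), `rowDiff_mul_le` (bond-difference rows `≤ α′·G_R + G_C·β`).
* §3 THE COVARIANT DERIVATIVE `covD η R s = M_R ∘ ∇_η + M_{η⁻¹(R − 1)}`: `covD_apply` (`= η⁻¹(Σ_j R(x)_{ij} f(s x, j) − f(x, i))`, the print's shape),
  `mmulOp_comp_covD` (`M_C ∘ D^η = M_{CR} ∘ ∇_η + M_{C·η⁻¹(R−1)}`), **`hasMaj_comp_idef_coeffCovD_comp`** (THE FIRST TERM OF (3.52) WITH THE TRANSPORT,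
  SANDWICHED: `T′ ∘ 𝔇(M_{C′}∘D′^{η′}, M_C∘D^η) ∘ A ≤ (K_∇ + K_Φ)·e^{−ρd}·w(y′)`, `K_∇ = m₃A₁c_η + m_Tε_PA₁C` (14's first-order sandwich for the product
  `P = C·R`), `K_Φ = m_Tε_QA₀C` (14's zeroth-order sandwich for `Q = C·η⁻¹(R − 1)`), fits of `P`, `Q` as binders (§2 + §1 + 13b supply them)).

HONEST FRAMING ∕ LIMITS.  MECHANISM over hypothesis-SHAPED letters; `R` is any matrix coefficient (for the print: the coordinate matrix of
`exp(η ad_{A(b)})`, 16's `coordMat`); crude constants.  NE2⁺ NOT PRINTED, NOT proved; count-neutral (typed 28∕28; nothing discharged); one finite T⁴ at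
fixed ε — NOT infinite volume, NOT OS on ℝ⁴, NOT a mass gap, NOT Clay.
-/

noncomputable section

namespace Summit.QuantumFields.YangMills.BalabanUVNodes.N15.MatrixSpecies

open NormedSpace
open Literature.MathematicalPhysics.QuantumFieldTheory.Balaban1983to89
open Literature.MathematicalPhysics.QuantumFieldTheory.Balaban1983to89.T4EtaRateDefect (idef idef_apply idef_comp idef_add SlowWeight)
open Literature.MathematicalPhysics.QuantumFieldTheory.Balaban1983to89.T4EtaRateCoeffDefect (pull pull_apply)
open Literature.MathematicalPhysics.QuantumFieldTheory.Balaban1983to89.Beta.AveragingCorrectionJets (adCLM)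
open Literature.MathematicalPhysics.QuantumFieldTheory.Balaban1983to89.B9Eq349ConjugatedQTowerLetterLinear (exp_sub_one_le_exp_one_mul)
open Literature.Analysis.Calculus (norm_exp_sub_one_le)
open B6RandomWalk B11SectG B9SectDWeightedNeumann Finset
open Summit.QuantumFields.YangMills.BalabanUVNodes.N15.DerivDefect

/-! ## §1 The transport species `exp(ηZ)` and fits of products -/

section Transport

variable {𝔸 : Type*} [NormedRing 𝔸] [NormedAlgebra ℝ 𝔸] [CompleteSpace 𝔸]

/-- THE TRANSPORT SPECIES `Phi0 η Z = e^{ηZ}` (value `1` at `η = 0`): the print's parallel transporter `R(U_b) = exp(iη ad_{A′(b)})` of (3.50) as a map on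
a normed algebra. [folklore] -/
def Phi0 (η : ℝ) (Z : 𝔸) : 𝔸 := exp (η • Z)

omit [CompleteSpace 𝔸] in
/-- At zero spacing the transport is the identity. [folklore] -/
@[simp] theorem Phi0_zero (Z : 𝔸) : Phi0 0 Z = 1 := by simp [Phi0]

/-- LETTER `K = e·η₀` for `Phi0` (13a's Duhamel–Lipschitz `norm_exp_sub_exp_le` at `ρ = 1`): on `0 ≤ η ≤ η₀`, `‖Z‖ ≤ r`, `η₀r ≤ 1`,
`‖e^{ηZ₁} − e^{ηZ₂}‖ ≤ e·η‖Z₁ − Z₂‖ ≤ (e·η₀)‖Z₁ − Z₂‖` — a Lipschitz constant that is ITSELF of rate one. [folklore] -/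
theorem Phi0_lipschitz {η₀ r : ℝ} (hreg : η₀ * r ≤ 1) :
    ∀ s, 0 ≤ s → s ≤ η₀ → ∀ Z₁ Z₂ : 𝔸, ‖Z₁‖ ≤ r → ‖Z₂‖ ≤ r →
      ‖Phi0 s Z₁ - Phi0 s Z₂‖ ≤ (Real.exp 1 * η₀) * ‖Z₁ - Z₂‖ := by
  intro s hs0 hs Z₁ Z₂ hZ₁ hZ₂
  have h1 := norm_smul_le_of_regime hreg hs0 hs hZ₁
  have h2 := norm_smul_le_of_regime hreg hs0 hs hZ₂
  have key := norm_exp_sub_exp_le (ρ := 1) (h1.1.trans h1.2) (h2.1.trans h2.2)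
  rw [← smul_sub, norm_smul, Real.norm_eq_abs, abs_of_nonneg hs0] at key
  unfold Phi0
  calc ‖exp (s • Z₁) - exp (s • Z₂)‖ ≤ Real.exp 1 * (s * ‖Z₁ - Z₂‖) := key
    _ ≤ Real.exp 1 * (η₀ * ‖Z₁ - Z₂‖) :=
        mul_le_mul_of_nonneg_left (mul_le_mul_of_nonneg_right hs (norm_nonneg _)) (Real.exp_pos 1).le
    _ = (Real.exp 1 * η₀) * ‖Z₁ - Z₂‖ := by ring

/-- LETTER `K′ = e·r` for `Phi0`: `‖e^{ηZ} − 1‖ ≤ e^{‖ηZ‖} − 1 ≤ e·‖ηZ‖ ≤ (e·r)·η` (tree `norm_exp_sub_one_le` + `exp_sub_one_le_exp_one_mul`). [folklore] -/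
theorem Phi0_consistency {η₀ r : ℝ} (hreg : η₀ * r ≤ 1) :
    ∀ s, 0 ≤ s → s ≤ η₀ → ∀ Z : 𝔸, ‖Z‖ ≤ r → ‖Phi0 s Z - Phi0 0 Z‖ ≤ (Real.exp 1 * r) * s := by
  intro s hs0 hs Z hZ
  have h1 := norm_smul_le_of_regime hreg hs0 hs hZ
  rw [Phi0_zero]
  unfold Phi0
  calc ‖exp (s • Z) - 1‖ ≤ Real.exp ‖s • Z‖ - 1 := norm_exp_sub_one_le _
    _ ≤ Real.exp 1 * ‖s • Z‖ := exp_sub_one_le_exp_one_mul (norm_nonneg _) (h1.1.trans h1.2)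
    _ ≤ Real.exp 1 * (s * r) := mul_le_mul_of_nonneg_left h1.1 (Real.exp_pos 1).le
    _ = (Real.exp 1 * r) * s := by ring

variable {X X' : Type*} {𝔄 : Type*} [NormedRing 𝔄] [NormedAlgebra ℝ 𝔄] [CompleteSpace 𝔄]

/-- THE PRINT's TRANSPORT `R(U_b) = exp(η ad_{A(b)})`: for `𝔄`-valued backgrounds `‖A′‖, ‖Ā‖ ≤ r`, regime `η₀(2r) ≤ 1`, `0 ≤ η′ ≤ η ≤ η₀` and the field fit
`‖A′(x′) − Ā(πx′)‖ ≤ o(πx′)`: `‖exp(η′ ad A′(x′)) − exp(η ad Ā(πx′))‖ ≤ 2(e·η₀)·o(πx′) + 2·(e·2r)·η` — BOTH terms of rate one (13b `fit_nonlinearV`).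
[folklore] -/
theorem fit_Phi0_ad (π : X' → X) {η₀ r η η' : ℝ} (hreg : η₀ * (2 * r) ≤ 1) (hr : 0 ≤ r) (hη' : 0 ≤ η') (hη'η : η' ≤ η) (hη : η ≤ η₀)
    {a' : X' → 𝔄} {a : X → 𝔄} (ha' : ∀ x', ‖a' x'‖ ≤ r) (ha : ∀ x, ‖a x‖ ≤ r)
    {o : X → ℝ} (hfit : ∀ x', ‖a' x' - a (π x')‖ ≤ o (π x')) (x' : X') :
    ‖Phi0 η' (adCLM ℝ (a' x')) - Phi0 η (adCLM ℝ (a (π x')))‖ ≤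
      (2 * (Real.exp 1 * η₀)) * o (π x') + 2 * (Real.exp 1 * (2 * r)) * η := by
  have hη₀ : 0 ≤ η₀ := hη'.trans (hη'η.trans hη)
  exact fit_nonlinearV π (fun s Z => Phi0 s (adCLM ℝ Z)) (by positivity) (by positivity)
    (lipschitz_comp_adCLM Phi0 (by positivity) (Phi0_lipschitz hreg))
    (consistency_comp_adCLM Phi0 (Phi0_consistency hreg)) hη' hη'η hη ha' ha hfit x'

omit [NormedAlgebra ℝ 𝔸] [CompleteSpace 𝔸] in
/-- LEIBNIZ FOR FITS OF PRODUCTS: `‖a′b′ − ab‖ ≤ ‖a′‖·‖b′ − b‖ + ‖a′ − a‖·‖b‖` (`a′b′ − ab = a′(b′ − b) + (a′ − a)b`). [folklore] -/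
theorem norm_mul_sub_mul_le_of (a' a b' b : 𝔸) : ‖a' * b' - a * b‖ ≤ ‖a'‖ * ‖b' - b‖ + ‖a' - a‖ * ‖b‖ := by
  have key : a' * b' - a * b = a' * (b' - b) + (a' - a) * b := by noncomm_ring
  rw [key]
  exact (norm_add_le _ _).trans (add_le_add (norm_mul_le _ _) (norm_mul_le _ _))

end Transport

/-! ## §2 Products of matrix coefficients on the product carrier: row letters multiply -/

section Products

variable {X : Type} {ι : Type} [Fintype ι] [DecidableEq ι]

omit [DecidableEq ι] in
/-- `M_C ∘ M_R = M_{CR}` (pointwise matrix product). [folklore] -/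
theorem mmulOp_comp_mmulOp (C R : X → Matrix ι ι ℝ) : mmulOp C ∘ₗ mmulOp R = mmulOp (fun x => C x * R x) := by
  ext f p
  simp only [LinearMap.comp_apply, mmulOp_apply, Matrix.mul_apply, Finset.sum_mul, Finset.mul_sum]
  rw [Finset.sum_comm]
  exact Finset.sum_congr rfl fun j _ => Finset.sum_congr rfl fun k _ => by ring

omit [DecidableEq ι] in
/-- ROW SUMS OF A PRODUCT: rows of `|C|` `≤ α`, rows of `|R|` `≤ β` (`β ≥ 0`) ⟹ rows of `|CR|` `≤ αβ`. [folklore] -/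
theorem row_abs_sum_mul_le {C R : Matrix ι ι ℝ} {α β : ℝ} (hβ : 0 ≤ β) (hC : ∀ i, ∑ j, |C i j| ≤ α) (hR : ∀ i, ∑ j, |R i j| ≤ β)
    (i : ι) : ∑ j, |(C * R) i j| ≤ α * β := by
  calc ∑ j, |(C * R) i j| = ∑ j, |∑ k, C i k * R k j| := by simp only [Matrix.mul_apply]
    _ ≤ ∑ j, ∑ k, |C i k| * |R k j| :=
        Finset.sum_le_sum fun j _ => (Finset.abs_sum_le_sum_abs _ _).trans (le_of_eq (Finset.sum_congr rfl fun k _ => abs_mul _ _))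
    _ = ∑ k, |C i k| * ∑ j, |R k j| := by rw [Finset.sum_comm]; simp only [Finset.mul_sum]
    _ ≤ ∑ k, |C i k| * β := Finset.sum_le_sum fun k _ => mul_le_mul_of_nonneg_left (hR k) (abs_nonneg _)
    _ = (∑ k, |C i k|) * β := by rw [Finset.sum_mul]
    _ ≤ α * β := mul_le_mul_of_nonneg_right (hC i) hβ

omit [DecidableEq ι] in
/-- FIT ROWS OF A PRODUCT (Leibniz): rows of `|C′|` `≤ α′`, of `|R|` `≤ β` (`≥ 0`), fit rows of `R` `≤ o_R`, of `C` `≤ o_C` ⟹ fit rows of `CR` `≤ α′o_R + o_Cβ`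
(`C′R′ − CR = C′(R′ − R) + (C′ − C)R`). [folklore] -/
theorem rowFit_mul_le {C' C R' R : Matrix ι ι ℝ} {α' β oC oR : ℝ} (hβ : 0 ≤ β) (hoR : 0 ≤ oR)
    (hC' : ∀ i, ∑ j, |C' i j| ≤ α') (hR : ∀ i, ∑ j, |R i j| ≤ β)
    (hfitC : ∀ i, ∑ j, |C' i j - C i j| ≤ oC) (hfitR : ∀ i, ∑ j, |R' i j - R i j| ≤ oR) (i : ι) :
    ∑ j, |(C' * R') i j - (C * R) i j| ≤ α' * oR + oC * β := by
  have key : C' * R' - C * R = C' * (R' - R) + (C' - C) * R := by noncomm_ring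
  have h1 := row_abs_sum_mul_le (C := C') (R := R' - R) hoR hC' (fun k => by simpa [Matrix.sub_apply] using hfitR k) i
  have h2 := row_abs_sum_mul_le (C := C' - C) (R := R) hβ (fun k => by simpa [Matrix.sub_apply] using hfitC k) hR i
  calc ∑ j, |(C' * R') i j - (C * R) i j| = ∑ j, |(C' * (R' - R) + (C' - C) * R) i j| := by
        refine Finset.sum_congr rfl fun j _ => ?_
        rw [← Matrix.sub_apply, key]
    _ ≤ ∑ j, (|(C' * (R' - R)) i j| + |((C' - C) * R) i j|) :=
        Finset.sum_le_sum fun j _ => by rw [Matrix.add_apply]; exact abs_add_le _ _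
    _ = ∑ j, |(C' * (R' - R)) i j| + ∑ j, |((C' - C) * R) i j| := Finset.sum_add_distrib
    _ ≤ α' * oR + oC * β := add_le_add h1 h2

omit [DecidableEq ι] in
/-- BOND-DIFFERENCE ROWS OF A PRODUCT field (the letter `G` of 14's `hasMaj_comp_mmulOp_bdiffN` for `P = C·R`): from rows `|C(x)| ≤ α`, `|R(x)| ≤ β` and
difference rows `Σ_j|η⁻¹(C(x) − C(ux))_{ij}| ≤ G_C`, `Σ_j|η⁻¹(R(x) − R(ux))_{ij}| ≤ G_R`: `Σ_j|η⁻¹((CR)(x) − (CR)(ux))_{ij}| ≤ αG_R + G_Cβ`. [folklore] -/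
theorem rowDiff_mul_le {C R : X → Matrix ι ι ℝ} (u : X → X) {η α β GC GR : ℝ} (hβ : 0 ≤ β) (hGR : 0 ≤ GR)
    (hC : ∀ x i, ∑ j, |C x i j| ≤ α) (hR : ∀ x i, ∑ j, |R x i j| ≤ β)
    (hdC : ∀ x i, ∑ j, |η⁻¹ * (C x i j - C (u x) i j)| ≤ GC) (hdR : ∀ x i, ∑ j, |η⁻¹ * (R x i j - R (u x) i j)| ≤ GR) (x : X) (i : ι) :
    ∑ j, |η⁻¹ * ((C x * R x) i j - (C (u x) * R (u x)) i j)| ≤ α * GR + GC * β := by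
  -- apply the fit lemma to the RESCALED differences `η⁻¹(R − Ru)`, `η⁻¹(C − Cu)`
  have hfitR : ∀ k, ∑ j, |(η⁻¹ • R x) k j - (η⁻¹ • R (u x)) k j| ≤ GR := fun k => by
    simpa [Matrix.smul_apply, smul_eq_mul, mul_sub] using hdR x k
  have hfitC : ∀ k, ∑ j, |(η⁻¹ • C x) k j - (η⁻¹ • C (u x)) k j| ≤ GC := fun k => by
    simpa [Matrix.smul_apply, smul_eq_mul, mul_sub] using hdC x k
  -- `η⁻¹(C′R′ − CR) = C′·η⁻¹(R′ − R) + η⁻¹(C′ − C)·R`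
  have key : ∀ j, η⁻¹ * ((C x * R x) i j - (C (u x) * R (u x)) i j) =
      (C x * (η⁻¹ • R x - η⁻¹ • R (u x))) i j + ((η⁻¹ • C x - η⁻¹ • C (u x)) * R (u x)) i j := by
    intro j
    simp only [Matrix.mul_apply, Matrix.sub_apply, Matrix.smul_apply, smul_eq_mul, Finset.mul_sum, ← Finset.sum_add_distrib,
      ← Finset.sum_sub_distrib]
    exact Finset.sum_congr rfl fun k _ => by ring
  have h1 := row_abs_sum_mul_le (C := C x) (R := η⁻¹ • R x - η⁻¹ • R (u x)) hGR (hC x)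
    (fun k => by simpa [Matrix.sub_apply] using hfitR k) i
  have h2 := row_abs_sum_mul_le (C := η⁻¹ • C x - η⁻¹ • C (u x)) (R := R (u x)) hβ
    (fun k => by simpa [Matrix.sub_apply] using hfitC k) (hR (u x)) i
  calc ∑ j, |η⁻¹ * ((C x * R x) i j - (C (u x) * R (u x)) i j)|
      = ∑ j, |(C x * (η⁻¹ • R x - η⁻¹ • R (u x))) i j + ((η⁻¹ • C x - η⁻¹ • C (u x)) * R (u x)) i j| :=
        Finset.sum_congr rfl fun j _ => by rw [key j]
    _ ≤ ∑ j, (|(C x * (η⁻¹ • R x - η⁻¹ • R (u x))) i j| + |((η⁻¹ • C x - η⁻¹ • C (u x)) * R (u x)) i j|) :=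
        Finset.sum_le_sum fun j _ => abs_add_le _ _
    _ = _ := Finset.sum_add_distrib
    _ ≤ α * GR + GC * β := add_le_add h1 h2

end Products

/-! ## §3 The covariant derivative as `M_R ∘ ∇_η + M_{η⁻¹(R − 1)}`; the first term of (3.52) with the transport, sandwiched -/

section CovD

variable {X X' : Type} {ι : Type} [Fintype ι] [DecidableEq ι]

/-- THE COVARIANT DERIVATIVE of the print's shape (3.50) on the product carrier: `covD η R s = M_R ∘ ∇_η + M_{η⁻¹(R − 1)}` for a transport coefficient
`R : X → Matrix ι ι ℝ` (the coordinate matrix of `exp(η ad_{A(b)})`) along the shift `s`. [folklore] -/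
def covD (η : ℝ) (R : X → Matrix ι ι ℝ) (s : X → X) : (X × ι → ℝ) →ₗ[ℝ] (X × ι → ℝ) :=
  mmulOp R ∘ₗ fdiffN η (liftMap s ι) + mmulOp (fun x => η⁻¹ • (R x - 1))

/-- THE PRINT's SHAPE: `(D^η f)(x, i) = η⁻¹·(Σ_j R(x)_{ij} f(s x, j) − f(x, i))` — the field at the far end read THROUGH the transport, minus the field.
[folklore] -/
theorem covD_apply (η : ℝ) (R : X → Matrix ι ι ℝ) (s : X → X) (f : X × ι → ℝ) (p : X × ι) :
    covD η R s f p = η⁻¹ * (∑ j, R p.1 p.2 j * f (s p.1, j) - f p) := by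
  have h1 : (mmulOp R ∘ₗ fdiffN η (liftMap s ι)) f p = ∑ j, R p.1 p.2 j * (η⁻¹ * (f (s p.1, j) - f (p.1, j))) := rfl
  have h2 : (mmulOp (fun x => η⁻¹ • (R x - 1))) f p = ∑ j, (η⁻¹ * (R p.1 p.2 j - (1 : Matrix ι ι ℝ) p.2 j)) * f (p.1, j) := rfl
  rw [covD, LinearMap.add_apply, Pi.add_apply, h1, h2, ← Finset.sum_add_distrib]
  have hterm : ∀ j, R p.1 p.2 j * (η⁻¹ * (f (s p.1, j) - f (p.1, j))) + η⁻¹ * (R p.1 p.2 j - (1 : Matrix ι ι ℝ) p.2 j) * f (p.1, j) =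
      η⁻¹ * (R p.1 p.2 j * f (s p.1, j)) - (if p.2 = j then η⁻¹ * f (p.1, j) else 0) := by
    intro j
    rw [Matrix.one_apply]
    split_ifs <;> ring
  rw [Finset.sum_congr rfl fun j _ => hterm j, Finset.sum_sub_distrib, Finset.sum_ite_eq, if_pos (Finset.mem_univ _),
    ← Finset.mul_sum, Prod.mk.eta, mul_sub]

/-- `M_C ∘ D^η = M_{CR} ∘ ∇_η + M_{C·η⁻¹(R − 1)}`: the first term of (3.52) WITH the transport is a first-order matrix term plus a zeroth-order matrix term
whose coefficients are PRODUCTS. [folklore] -/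
theorem mmulOp_comp_covD (η : ℝ) (C R : X → Matrix ι ι ℝ) (s : X → X) :
    mmulOp C ∘ₗ covD η R s =
      mmulOp (fun x => C x * R x) ∘ₗ fdiffN η (liftMap s ι) + mmulOp (fun x => C x * (η⁻¹ • (R x - 1))) := by
  unfold covD
  rw [LinearMap.comp_add, ← LinearMap.comp_assoc, mmulOp_comp_mmulOp, mmulOp_comp_mmulOp]

variable [Fintype X] [Fintype X'] (D : LineData X X') {g : B6.Geometry} (blk : X → g.Site)
variable {F₁ F₃ : Type} [AddCommGroup F₁] [Module ℝ F₁] [AddCommGroup F₃] [Module ℝ F₃] {b₁ : BlockNorm g F₁} {b₃ : BlockNorm g F₃}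

/-- **THE FIRST TERM OF (3.52) WITH THE TRANSPORT INSIDE THE DERIVATIVE, SANDWICHED.**  Fine `V′ = M_{C′} ∘ D′^{η′}` (transport `R′`, shift `s′`), coarse
`V = M_C ∘ D^η` (transport `R`, shift `s`) on the product carriers; write `P = C·R` (first-order coefficient) and `Q = C·η⁻¹(R − 1)` (zeroth-order
coefficient).  Then `T′ ∘ 𝔇(V′, V) ∘ A ≤ (K_∇ + K_Φ)·e^{−ρd(y,y′)}·w(y′)`, `K_∇ = m₃A₁c_η + m_T(ε_PA₁C)` (part 14's first-order sandwich for `P`), `K_Φ =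
m_T(ε_QA₀C)` (part 14's zeroth-order sandwich for `Q`).  Binders: as in 14 — geometry, slow weight, `T′ ≤ N_T` (`‖N_T‖_ρ ≤ m_T`), the composite adjoint-derivative
entry of `T′∘M_{P′}` (`N₃`, `m₃`), `A ≤ A₀e^{−(ρ+σ)d}`, `∇_η∘A ≤ A₁e^{−(ρ+σ)d}`, `|η′|(M−1) ≤ c_η w`, and the max-row-sum fits `o_P ≤ ε_Pw`, `o_Q ≤ ε_Qw` of the
PRODUCT coefficients (§2 `rowFit_mul_le` from the factors' letters; the transport's by §1 + 16). [folklore] -/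
theorem hasMaj_comp_idef_coeffCovD_comp {η η' : ℝ} (hη' : η' ≠ 0) (hMη : (D.M : ℝ) * η' = η) (htri : Triangle254 g)
    (hd : ∀ a b : g.Site, 0 ≤ g.dist a b) (hdiag : ∀ y, g.dist y y = 0) {ρ σ Cw εP εQ A₀ A₁ m_T m₃ cη : ℝ} (hρ : 0 ≤ ρ) (hσ : 0 ≤ σ)
    (hA₀ : 0 ≤ A₀) (hA₁ : 0 ≤ A₁) (hCw : 0 ≤ Cw) (hεP : 0 ≤ εP) (hεQ : 0 ≤ εQ) {w oP oQ : g.Site → ℝ} (hw : ∀ y, 0 ≤ w y)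
    (hsw : SlowWeight g σ Cw w) (hηw : ∀ y', |η'| * ((D.M : ℝ) - 1) ≤ cη * w y')
    (hoP : ∀ y, 0 ≤ oP y) (howP : ∀ y, oP y ≤ εP * w y) (hoQ : ∀ y, 0 ≤ oQ y) (howQ : ∀ y, oQ y ≤ εQ * w y)
    {C' R' : X' → Matrix ι ι ℝ} {C R : X → Matrix ι ι ℝ}
    (hfitP : ∀ x' i, ∑ j, |(C' x' * R' x') i j - (C (D.π x') * R (D.π x')) i j| ≤ oP (blk (D.π x')))
    (hfitQ : ∀ x' i, ∑ j, |(C' x' * (η'⁻¹ • (R' x' - 1))) i j - (C (D.π x') * (η⁻¹ • (R (D.π x') - 1))) i j| ≤ oQ (blk (D.π x')))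
    {T' : (X' × ι → ℝ) →ₗ[ℝ] F₃} {A : F₁ →ₗ[ℝ] (X × ι → ℝ)} {N_T N₃ : g.Site → g.Site → ℝ}
    (hNT : ∀ a b, 0 ≤ N_T a b) (hmT : WRow g ρ N_T m_T) (hT : HasMaj (BlockNorm.ofBlocks g (liftBlk (blk ∘ D.π) ι)) b₃ T' N_T)
    (hN₃ : ∀ a b, 0 ≤ N₃ a b) (hm₃ : WRow g ρ N₃ m₃)
    (hS : HasMaj (BlockNorm.ofBlocks g (liftBlk (blk ∘ D.π) ι)) b₃
      ((T' ∘ₗ mmulOp fun x' => C' x' * R' x') ∘ₗ bdiffN η' (prodLine D ι).s') N₃)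
    (hA : HasMaj b₁ (BlockNorm.ofBlocks g (liftBlk blk ι)) A (fun y y' => A₀ * Real.exp (-((ρ + σ) * g.dist y y'))))
    (hdA : HasMaj b₁ (BlockNorm.ofBlocks g (liftBlk blk ι)) (fdiffN η (prodLine D ι).s ∘ₗ A)
      (fun y y' => A₁ * Real.exp (-((ρ + σ) * g.dist y y')))) :
    HasMaj b₁ b₃ (T' ∘ₗ idef (pull (prodLine D ι).π) (pull (prodLine D ι).π)
        (mmulOp C' ∘ₗ covD η' R' D.s') (mmulOp C ∘ₗ covD η R D.s) ∘ₗ A)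
      (fun y y' => ((m₃ * A₁ * cη + m_T * (εP * A₁ * Cw)) + m_T * (εQ * A₀ * Cw)) * Real.exp (-(ρ * g.dist y y')) * w y') := by
  -- decompose both runs' operators: `M_C ∘ D^η = M_P ∘ ∇ + M_Q`
  have hdec' : mmulOp C' ∘ₗ covD η' R' D.s' =
      mmulOp (fun x' => C' x' * R' x') ∘ₗ fdiffN η' (prodLine D ι).s' + mmulOp (fun x' => C' x' * (η'⁻¹ • (R' x' - 1))) :=
    mmulOp_comp_covD η' C' R' D.s'
  have hdec : mmulOp C ∘ₗ covD η R D.s =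
      mmulOp (fun x => C x * R x) ∘ₗ fdiffN η (prodLine D ι).s + mmulOp (fun x => C x * (η⁻¹ • (R x - 1))) :=
    mmulOp_comp_covD η C R D.s
  rw [hdec', hdec]
  -- the two sandwiches of part 14
  have h1 := hasMaj_comp_idef_firstOrderM_comp D ι blk (b₁ := b₁) (b₃ := b₃) (C' := fun x' => C' x' * R' x')
    (Cc := fun x => C x * R x) hη' hMη htri hd hdiag hρ hσ hA₁ hCw hεP hw hsw hηw hoP howP hfitP hNT hmT hT hN₃ hm₃ hS hdA
  have h2 := hasMaj_comp_idef_mmulOp_comp (b₁ := b₁) (b₃ := b₃) (ι := ι) blk D.π (C' := fun x' => C' x' * (η'⁻¹ • (R' x' - 1)))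
    (Cc := fun x => C x * (η⁻¹ • (R x - 1))) htri hdiag hρ hA₀ hCw hεQ hw hsw hoQ howQ hfitQ hNT hmT hT hA
  have hop : T' ∘ₗ idef (pull (prodLine D ι).π) (pull (prodLine D ι).π)
        (mmulOp (fun x' => C' x' * R' x') ∘ₗ fdiffN η' (prodLine D ι).s' + mmulOp (fun x' => C' x' * (η'⁻¹ • (R' x' - 1))))
        (mmulOp (fun x => C x * R x) ∘ₗ fdiffN η (prodLine D ι).s + mmulOp (fun x => C x * (η⁻¹ • (R x - 1)))) ∘ₗ A =
      T' ∘ₗ idef (pull (prodLine D ι).π) (pull (prodLine D ι).π)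
          (mmulOp (fun x' => C' x' * R' x') ∘ₗ fdiffN η' (prodLine D ι).s') (mmulOp (fun x => C x * R x) ∘ₗ fdiffN η (prodLine D ι).s) ∘ₗ A +
        T' ∘ₗ idef (pull (prodLine D ι).π) (pull (prodLine D ι).π)
          (mmulOp fun x' => C' x' * (η'⁻¹ • (R' x' - 1))) (mmulOp fun x => C x * (η⁻¹ • (R x - 1))) ∘ₗ A := by
    rw [idef_add]
    ext v
    simp only [LinearMap.comp_apply, LinearMap.add_apply, map_add]
  rw [hop]
  refine (h1.add h2).mono fun y y' => le_of_eq ?_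
  ring

end CovD

end Summit.QuantumFields.YangMills.BalabanUVNodes.N15.MatrixSpecies
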